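import Literature.Computability.Cryptography.PhiHidingThreeUnderBQPCollapse
import Literature.Computability.Complexity.PromiseAdleman
import Literature.Computability.Complexity.BPPErrorReduction
import Literature.Computability.Complexity.CircuitEval

/-!
# Companion of `STUB-IDEAS-stub_phiHiding3-2.md` (stub-ideation k=2, FAMILY 2 — RESHAPE) for
`stub_phiHiding3` of crux `PureCubicClassNumberHard` (stmt-QuantumAdvantage-11826)

Elaboration sanity of the PROPOSED HELPER LEMMAS only (statements H0–H6 with `sorry` bodies),
plus the sorry-free ASSEMBLY `helper lemmas ⇒ stub` (`phiH3_of_nonUniform`,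
`stub_phiHiding3_of_nonUniform`, `not_mem_PromiseBPP'_of_phiH3`, `phiH3_iff_at`).
NOT a line, NOT registered: no `stub_*` names, no `<CruxDecl>_of`.
-/

set_option linter.dupNamespace false

namespace Summit.QuantumAdvantage.QuantumAdvantage.Cruxes.PureCubicClassNumberHard.HondaLeak.StubIdeas2

open Literature.Computability.Complexity _root_.Computability

/-- The pure-cubic Φ-hiding(3) promise family of the stub. -/
def PhiH3Family (p q : ℕ) : Prop :=
  p.Prime ∧ q.Prime ∧ p ≠ q ∧ (p * q) % 9 = 1 ∧
    ((p % 3 = 1 ∧ q % 3 = 1) ∨ (p % 9 = 2 ∧ q % 9 = 5) ∨ (p % 9 = 5 ∧ q % 9 = 2))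

/-- The stub `stub_phiHiding3`, verbatim, as a `Prop`. -/
def PhiH3 : Prop :=
  ¬ ∃ D : RandAlg (List Bool) Bool, D.IsPolyTime id encodeBool ∧
      ∀ p q : ℕ, p.Prime → q.Prime → p ≠ q → (p * q) % 9 = 1 →
        ((p % 3 = 1 ∧ q % 3 = 1) ∨ (p % 9 = 2 ∧ q % 9 = 5) ∨ (p % 9 = 5 ∧ q % 9 = 2)) →
        (2 : ℝ) / 3 ≤ D.pr id (encodeNat (p * q)) {b | b = decide (p % 3 = 1)}

/-- `Π_Φ3`: the stub's decision task as a textbook promise problem over `{0,1}*`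
(yes = codes of split-type moduli `p ≡ q ≡ 1 (3)`, no = codes of `{2,5}`-inert-type moduli). -/
def phiH3Promise : PromiseProblem where
  yes := {x | ∃ p q, PhiH3Family p q ∧ p % 3 = 1 ∧ x = encodeNat (p * q)}
  no := {x | ∃ p q, PhiH3Family p q ∧ p % 3 ≠ 1 ∧ x = encodeNat (p * q)}

/-- Gill-machine promise-`BPP` in the tree's `RandAlg` model (bounded but possibly
non-computable coin budget: PPT with `O(log n)` advice, Disproof §7b). GENERIC. -/
def RPromiseBPP : Set PromiseProblem :=
  {Q | ∃ D : RandAlg (List Bool) Bool, D.IsPolyTime id encodeBool ∧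
    (∀ x ∈ Q.yes, (2 : ℝ) / 3 ≤ D.pr id x {true}) ∧ (∀ x ∈ Q.no, (2 : ℝ) / 3 ≤ D.pr id x {false})}

/-- Same class at success threshold `c`. GENERIC. -/
def RPromiseBPPAt (c : ℝ) : Set PromiseProblem :=
  {Q | ∃ D : RandAlg (List Bool) Bool, D.IsPolyTime id encodeBool ∧
    (∀ x ∈ Q.yes, c ≤ D.pr id x {true}) ∧ (∀ x ∈ Q.no, c ≤ D.pr id x {false})}

/-! ## Plan A helper lemmas -/

/-- H0 (S): the stub IS promise non-membership of `Π_Φ3` in the Gill-machine class. -/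
theorem phiH3_iff_not_mem_RPromiseBPP : PhiH3 ↔ phiH3Promise ∉ RPromiseBPP := by
  sorry

/-- H1 (S/M, GENERIC): textbook promise-BPP (exact polynomial coins, `L' ∈ P`) is inside the
Gill-machine class — the (→) half of `mem_BPP_iff_randAlg_holds`, run on the promise. -/
theorem PromiseBPP'_subset_RPromiseBPP : PromiseBPP' ⊆ RPromiseBPP := by
  sorry

/-- H2a (M, GENERIC): the witness step of Adleman for Gill machines — coin table as advice,
prefix-uniformity `uniformProb_take_of_le`, `RandAlg.pr_eq_uniformProb`. -/
theorem exists_polyAdvice_witness_of_mem_RPromiseBPP {Q : PromiseProblem} (hQ : Q ∈ RPromiseBPP) :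
    ∃ L' ∈ polyAdvice Classes.P, ∃ c : Polynomial ℕ,
      (∀ x ∈ Q.yes, (2 : ℝ) / 3 ≤ uniformProb (c.eval x.length) {y : List Bool | boolPair x y ∈ L'}) ∧
      (∀ x ∈ Q.no, (2 : ℝ) / 3 ≤ uniformProb (c.eval x.length) {y : List Bool | boolPair x y ∉ L'}) := by
  sorry

/-- H2 (S given H2a, GENERIC): Adleman's theorem for the Gill-machine promise class. -/
theorem RPromiseBPP_subset_promiseLift_PPoly : RPromiseBPP ⊆ promiseLift PPoly := by
  intro Q hQ
  obtain ⟨L', hL', c, hyes, hno⟩ := exists_polyAdvice_witness_of_mem_RPromiseBPP hQ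
  have hPP : L' ∈ PPoly := by rw [PPoly_eq_polyAdvice_P_holds]; exact hL'
  exact mem_promiseLift_PPoly_of_bp_witness hPP c hyes hno

/-- H3 (M+, GENERIC, optional): threshold robustness of the Gill-machine class
(`k`-fold majority with block length `|r|/k`; Chebyshev/`card_majority_fail_le`). -/
theorem RPromiseBPPAt_eq_RPromiseBPP {c : ℝ} (hc : 1 / 2 < c) (hc' : c < 1) :
    RPromiseBPPAt c = RPromiseBPP := by
  sorry

/-! ## Assembly: helper lemmas ⇒ stub (sorry-free compositions) -/

/-- THE RE-TYPED LEAF: non-uniform worst-case Φ-hiding(3) — no polynomial-size circuit family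
separates split-type from `{2,5}`-inert-type codes. (Hypothesis-type; this is what the line
would assume instead of the RandAlg-typed stub.) -/
def PhiH3NonUniform : Prop := phiH3Promise ∉ promiseLift PPoly

theorem phiH3_of_nonUniform (h : PhiH3NonUniform) : PhiH3 :=
  phiH3_iff_not_mem_RPromiseBPP.2 fun hmem => h (RPromiseBPP_subset_promiseLift_PPoly hmem)

theorem not_mem_PromiseBPP'_of_phiH3 (h : PhiH3) : phiH3Promise ∉ PromiseBPP' :=
  fun hmem => phiH3_iff_not_mem_RPromiseBPP.1 h (PromiseBPP'_subset_RPromiseBPP hmem)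

/-- The stub's verbatim statement from the re-typed leaf. -/
theorem stub_phiHiding3_of_nonUniform (h : PhiH3NonUniform) :
    ¬ ∃ D : RandAlg (List Bool) Bool, D.IsPolyTime id encodeBool ∧
      ∀ p q : ℕ, p.Prime → q.Prime → p ≠ q → (p * q) % 9 = 1 →
        ((p % 3 = 1 ∧ q % 3 = 1) ∨ (p % 9 = 2 ∧ q % 9 = 5) ∨ (p % 9 = 5 ∧ q % 9 = 2)) →
        (2 : ℝ) / 3 ≤ D.pr id (encodeNat (p * q)) {b | b = decide (p % 3 = 1)} :=
  phiH3_of_nonUniform h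

/-- Threshold-robust form of the stub (uses H3). -/
theorem phiH3_iff_at {c : ℝ} (hc : 1 / 2 < c) (hc' : c < 1) :
    PhiH3 ↔ phiH3Promise ∉ RPromiseBPPAt c := by
  rw [RPromiseBPPAt_eq_RPromiseBPP hc hc', phiH3_iff_not_mem_RPromiseBPP]

/-! ## Plan B helper lemmas: Karp-identical presentations of the hidden bit on the family -/

/-- H4 (S): Φ-hiding form. -/
theorem mod_three_eq_one_iff_three_dvd_totient {p q : ℕ} (h : PhiH3Family p q) :
    p % 3 = 1 ↔ 3 ∣ Nat.totient (p * q) := by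
  sorry

/-- H4' (S): on this family `3 ∣ φ(N) ↔ 9 ∣ φ(N)` (the `e²`-lossy variant). -/
theorem mod_three_eq_one_iff_nine_dvd_totient {p q : ℕ} (h : PhiH3Family p q) :
    p % 3 = 1 ↔ 9 ∣ Nat.totient (p * q) := by
  sorry

/-- H5 (S/M): RSA-key-certification form — the no-instances are exactly the moduli for which
`(N, e = 3)` is a valid RSA key (cubing permutes `(ℤ/N)ˣ`); `powCoprime` / Cauchy. -/
theorem mod_three_ne_one_iff_pow_three_bijective {p q : ℕ} (h : PhiH3Family p q) :
    p % 3 ≠ 1 ↔ Function.Bijective (fun x : (ZMod (p * q))ˣ => x ^ 3) := by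
  sorry

/-- H6 (M, optional): Eisenstein-norm form — yes-instances are the norms from `ℤ[ζ₃]`. -/
theorem mod_three_eq_one_iff_eisensteinNorm {p q : ℕ} (h : PhiH3Family p q) :
    p % 3 = 1 ↔ ∃ a b : ℤ, a ^ 2 - a * b + b ^ 2 = ((p * q : ℕ) : ℤ) := by
  sorry

/-- Sanity: the promise is disjoint (unique factorisation + `encodeNat` injective). (S) -/
theorem phiH3Promise_disjoint : phiH3Promise.Disjoint := by
  sorry

end Summit.QuantumAdvantage.QuantumAdvantage.Cruxes.PureCubicClassNumberHard.HondaLeak.StubIdeas2
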